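import Summits.AnomalousDissipation.AnomalousDissipation.Theses.SawtoothPulseCascade
import Summits.AnomalousDissipation.AnomalousDissipation.Theorems.SawtoothPulseCascadeK2ClassicalEnergyRung
import Summits.AnomalousDissipation.AnomalousDissipation.Theorems.SawtoothPulseCascadeK2ClassicalWindow
import Summits.AnomalousDissipation.AnomalousDissipation.Theorems.SawtoothPulseCascadeK2ParallelDatum
import Summits.AnomalousDissipation.AnomalousDissipation.Theorems.SawtoothPulseCascadeK2InjectionCrossStream
import HarnessLib
import HarnessLib.Audit

/-!
# VARIANT (prover leafhand-ad-sawtoothpulsecasca-3 g0, 2026-08-31; NOT a re-registration): the registered line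
# `phase-cocycle` (skeleton 0c87d78a) with STUB A DISCHARGED to the cross-stream bound — `stub_injectionPhase :=
# K2Classical.injectionPhase_of_crossStream crossStreamBound_V` (tree theorem, p798971), where the new sorry
# `crossStreamBound_V` asks only: on the V half-slot of phase `j₀`, the CROSS-STREAM component `(W t x)₀` of every classical
# linearised response from ONE neutral streamwise harmonic `Re (e_{l e₁} z)` (`z₁ = 0`, `l` an odd multiple of `N_{j₀}`)
# has `∫ (W t x)₀² ≤ 2² ‖W(a)‖²`, for `γ ∈ (5.77, 8]`.  Farm check: rc 0, sorries 2 (`crossStreamBound_V`, `stub_phaseCocycle`);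
# `K2LinearisedCascadeGrowth_of` unchanged.  Everything below the test stub is the registered skeleton byte-identical.
#
# SawtoothPulseCascade — BC3 skeleton (re-registration) for the rank-2 crux K2″ `K2LinearisedCascadeGrowth`
over its rev-12 CLASSICAL body (item stmt-AnomalousDissipation-19696; route rev 12, commit f65c3c0ff5a2):

  `K2LinearisedCascadeGrowth := ∀ γ ∈ Icc 4 8, ∀ ρN ∈ {2,…,7}, K2PhaseGrowthClassical ⟨γ, 1/4, 2, 1, ρN⟩ 3`.

LINE `phase-cocycle` (replaces the STALE birth skeleton of 2026-08-25 that sat on the retired weak-class item 20025,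
whose only load-bearing stub `stub_linearisedGrowth : σ⋆-cert → Bloch-cert → integer-harmonics-cert → K2″` took three
inputs that are now tree theorems, i.e. it was the crux restated).  The present cut follows the ENVELOPE COCYCLE that the
cell's numerics actually measured (per-phase envelope ratios: kit j244065/j245608 at ρN = 2, γ ∈ {4, 12}; kit j247867/j248157
at the in-band corners (4,6), (4,7), (5,7): L = 3.91 / 3.94 / 4.95 against the cap 3e^{σ⋆γ} = 10.4 / 10.4 / 14.1):

* `stub_injectionPhase` (L) — the INJECTION PHASE: a residual-comb injection at phase `j₀` (H or V half) is amplified in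
  `L²` by at most `3e^{σ⋆γ}` up to the end of phase `j₀` (uniform envelope on `[tInject j₀ hz, tStart (j₀+1)]`), for
  `ν ∈ (0, ν₀]`.  Its V half (`hz = false`) is the landed theorem `K2Classical.k2_injectionPhase_V` (factor 1, every ν > 0,
  p458821); its H half is: exact parallel heat flow during the H slot (`K2Classical.parallel_H_of_datum`, factor 1) followed by
  the V slot of the SAME phase acting on a streamwise comb at the INTEGER relative wavenumbers `(2n+1) ≥ 1 > 0.7638` — the
  modally NEUTRAL band of the sawtooth (`sawC2zero_natCast_pos`) — where the crude energy factor `e^{γ}` (tree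
  `linearised_energy_le_of_mem_V`) already gives the claim for `γ ≤ 2 ln 3 / (1 − 2σ⋆) = 5.78` and must be beaten by ≤ 2.4×
  on `(5.78, 8]` using that neutrality.
* `stub_phaseCocycle` (XL, LOAD-BEARING) — the ONE-PHASE TRANSFER for comb-generated states: along every classical linearised
  response emanating from a residual-comb injection at phase `j₀`, the `L²` envelope over phase `J+1` is at most `(3e^{σ⋆γ})²`
  times the envelope over `[tInject j₀ hz, tStart (J+1)]` (`j₀ ≤ J`), uniformly in `ν ∈ (0, ν₀]`, `j₀`, `J`.  This is exactly the
  measured quantity; it is where the Kelvin–Helmholtz line-spectrum rate `σ⋆` (tree `sawSigma_le_sawSigmaStar`), Bloch domination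
  (`sq_mul_neg_sawC2_le_max`) and the absence of Orr transients for already-tilted comb states must be turned into a proof.
* composition `K2LinearisedCascadeGrowth_of` — KERNEL-CHECKED (no sorry outside the two stubs): `min` of the two thresholds,
  induction over the phases with restriction of classical solutions to sub-windows (`IsSmoothSpaceTimeOn.mono` + agreement of the
  one-sided time derivative on nested closed intervals), `(K²)^{n+1} = K^{2(J+1−j₀)}`.
* BC5 rungs, PRESENT as theorems (sorry-free, cited by name): `rung_energyConstant` = `K2Classical.k2PhaseGrowthClassical_exp_box`
  (the crux with the energy-method constant `e^{(1−σ⋆)γ}` in place of 3; p452366) and `rung_injectionPhase_V` = the `hz = false`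
  half of `stub_injectionPhase` with factor 1 for EVERY ν > 0 (from `K2Classical.k2_injectionPhase_V`, p458821).

Planner seat ad-ideate-p2 g10, 2026-08-26.  Farm-checked; sorries = the two stubs only.
-/

-- `Summit.<Summit>.<Problem>`: single-conjunct summit, the duplicate namespace segment is deliberate.
set_option linter.dupNamespace false

noncomputable section

namespace Summit.AnomalousDissipation.AnomalousDissipation.Cruxes.K2LinearisedCascadeGrowth.PhaseCocycle

open Set MeasureTheory
open Literature.Analysis Literature.Analysis.FunctionSpaces Literature.Analysis.FluidPDE
open Literature.Analysis.FluidPDE.SawtoothCascade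
open Literature.Analysis.FluidPDE.SawtoothCascade.CascadeParams
open Summit.AnomalousDissipation.AnomalousDissipation.Theses.SawtoothPulseCascade
open Summit.AnomalousDissipation.AnomalousDissipation.Theorems.SawtoothPulseCascade

/-! ## The two registered stubs -/

/-- NEW STUB A′ (replaces the content of `stub_injectionPhase`): the cross-stream bound of
`K2Classical.injectionPhase_of_crossStream` — `L²` amplification ≤ 2 of the cross-stream velocity of one modally neutral
streamwise harmonic on the V half-slot, `γ ∈ (5.77, 8]`, uniformly in `j₀` and `ν ≤ ν₀` (size L: 1-D Orr–Sommerfeld IVP of the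
rounded viscous finite-time pulse; for the exact Couette strip the amplification from this datum is ≤ 1 by Orr's solution). -/
theorem crossStreamBound_V :
    ∀ γ ∈ Ioc (5.77 : ℝ) 8, ∀ ρN ∈ Finset.Icc 2 7, ∃ ν₀ : ℝ, 0 < ν₀ ∧ ∀ ν ∈ Ioc 0 ν₀, ∀ (j₀ : ℕ)
      (l : ℕ), 1 ≤ l → (∃ n : ℤ, (l : ℤ) = (2 * n + 1) * (((⟨γ, 1 / 4, 2, 1, ρN⟩ : CascadeParams).N j₀ : ℕ) : ℤ)) →
      ∀ z : EuclideanSpace ℂ (Fin 2), z 1 = 0 →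
      ∀ (W : ℝ → UnitAddTorus (Fin 2) → EuclideanSpace ℝ (Fin 2)) (Q : ℝ → UnitAddTorus (Fin 2) → ℝ),
      Torus.IsSmoothSpaceTimeOn (Icc (CascadeParams.tStart j₀ + CascadeParams.tHalf j₀)
        (CascadeParams.tStart (j₀ + 1))) W →
      Torus.IsSmoothSpaceTimeOn (Icc (CascadeParams.tStart j₀ + CascadeParams.tHalf j₀)
        (CascadeParams.tStart (j₀ + 1))) Q →
      (∀ s ∈ Icc (CascadeParams.tStart j₀ + CascadeParams.tHalf j₀) (CascadeParams.tStart (j₀ + 1)),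
        Torus.IsDivFree (W s)) →
      (∀ s ∈ Icc (CascadeParams.tStart j₀ + CascadeParams.tHalf j₀) (CascadeParams.tStart (j₀ + 1)), ∀ x,
        Torus.timeDerivWithin (Icc (CascadeParams.tStart j₀ + CascadeParams.tHalf j₀)
            (CascadeParams.tStart (j₀ + 1))) W s x +
          Torus.convect ((⟨γ, 1 / 4, 2, 1, ρN⟩ : CascadeParams).field s) (W s) x +
          Torus.convect (W s) ((⟨γ, 1 / 4, 2, 1, ρN⟩ : CascadeParams).field s) x =
          ν • Torus.laplacian (W s) x - Torus.gradient (Q s) x) →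
      W (CascadeParams.tStart j₀ + CascadeParams.tHalf j₀) =
        Torus.realTrigPoly {Pi.single 1 (l : ℤ)} (fun _ => z) →
      ∀ t ∈ Icc (CascadeParams.tStart j₀ + CascadeParams.tHalf j₀) (CascadeParams.tStart (j₀ + 1)),
        ∫ x, (W t x 0) ^ 2 ≤ 2 ^ 2 *
          Torus.vectorL2Sq (W (CascadeParams.tStart j₀ + CascadeParams.tHalf j₀)) := by
  sorry


/-- STUB A (L) — INJECTION PHASE.  For every box point `(γ, ρN) ∈ [4,8] × {2,…,7}` there is `ν₀ > 0` such that for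
`ν ∈ (0, ν₀]`, every phase `j₀`, every half-slot type `hz` and every residual-comb injection `w₀` at `tInject j₀ hz`, every
classical solution `(w, q)` of the Navier–Stokes equations linearised at the cascade carrier on `[tInject j₀ hz, tStart (j₀+1)]`
with `w (tInject j₀ hz) = w₀` satisfies `‖w(t)‖²_{L²} ≤ (3e^{σ⋆γ})² ‖w₀‖²_{L²}` on the WHOLE injection window.
Why it might fail: for `hz = true` and `γ ∈ (5.78, 8]` the crude energy factor `e^{γ}` of the same-phase V slot exceeds
`9e^{2σ⋆γ}` (by ≤ 2.4× at γ = 8), so the proof must use the modal neutrality of the integer relative wavenumbers of the comb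
(band edge 0.7638 < 1) for the ROUNDED profile (δ_j > 0) with viscosity — a non-modal stability estimate nobody has written.
Size L.  (`hz = false`: theorem `rung_injectionPhase_V` below, factor 1.) -/
theorem stub_injectionPhase :
    ∀ γ ∈ Icc (4 : ℝ) 8, ∀ ρN ∈ Finset.Icc 2 7, ∃ ν₀ : ℝ, 0 < ν₀ ∧ ∀ ν ∈ Ioc 0 ν₀, ∀ (j₀ : ℕ) (hz : Bool)
      (w₀ : UnitAddTorus (Fin 2) → EuclideanSpace ℝ (Fin 2))
      (w : ℝ → UnitAddTorus (Fin 2) → EuclideanSpace ℝ (Fin 2)) (q : ℝ → UnitAddTorus (Fin 2) → ℝ),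
      ShearCombDatum ((⟨γ, 1 / 4, 2, 1, ρN⟩ : CascadeParams).N j₀) hz w₀ →
      Torus.IsSmoothSpaceTimeOn (Icc (CascadeParams.tInject j₀ hz) (CascadeParams.tStart (j₀ + 1))) w →
      Torus.IsSmoothSpaceTimeOn (Icc (CascadeParams.tInject j₀ hz) (CascadeParams.tStart (j₀ + 1))) q →
      (∀ t ∈ Icc (CascadeParams.tInject j₀ hz) (CascadeParams.tStart (j₀ + 1)), Torus.IsDivFree (w t)) →
      (∀ t ∈ Icc (CascadeParams.tInject j₀ hz) (CascadeParams.tStart (j₀ + 1)), ∀ x,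
        Torus.timeDerivWithin (Icc (CascadeParams.tInject j₀ hz) (CascadeParams.tStart (j₀ + 1))) w t x +
          Torus.convect ((⟨γ, 1 / 4, 2, 1, ρN⟩ : CascadeParams).field t) (w t) x +
          Torus.convect (w t) ((⟨γ, 1 / 4, 2, 1, ρN⟩ : CascadeParams).field t) x =
          ν • Torus.laplacian (w t) x - Torus.gradient (q t) x) →
      w (CascadeParams.tInject j₀ hz) = w₀ →
      ∀ t ∈ Icc (CascadeParams.tInject j₀ hz) (CascadeParams.tStart (j₀ + 1)),
        Torus.vectorL2Sq (w t) ≤ (3 * Real.exp (sawSigmaStar * γ)) ^ 2 * Torus.vectorL2Sq w₀ :=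
  K2Classical.injectionPhase_of_crossStream crossStreamBound_V

/-- STUB B (XL, LOAD-BEARING) — ONE-PHASE ENVELOPE COCYCLE for comb-generated states.  For every box point there is
`ν₀ > 0` such that for `ν ∈ (0, ν₀]`, `j₀ ≤ J`, every half-slot type and residual-comb injection `w₀` at `tInject j₀ hz`,
every classical linearised solution `(w, q)` on `[tInject j₀ hz, tStart (J+2)]` with `w (tInject j₀ hz) = w₀`, and every
envelope `B` of `‖w(·)‖²_{L²}` on `[tInject j₀ hz, tStart (J+1)]`: `‖w(t)‖²_{L²} ≤ (3e^{σ⋆γ})² B` on phase `J+1`,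
i.e. on `[tStart (J+1), tStart (J+2)]`.
Why it might fail: at the in-band corners (γ, ρN) = (4,7), (5,7) the comb state tilted by the previous cross pulse re-enters
the UNSTABLE band of the next pulse (relative wavenumber ≈ γ/ρN = 0.57–0.71 < 0.7638), so two partially unstable pulses act in
one phase; the measured per-phase factors L = 3.94 / 4.95 (kit j248157, M = 4096; UNDECIDED of record by the hiwavE clause) sit only
×2.6 / ×2.9 below the cap 3e^{σ⋆γ}, and the proof needs a non-modal (Orr + critical-layer) bound for the time-dependent rounded
sawtooth pulse uniformly in j₀, J and ν ≤ ν₀ — no Lyapunov functional with condition number ≤ 3 is known.  Size XL. -/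
theorem stub_phaseCocycle :
    ∀ γ ∈ Icc (4 : ℝ) 8, ∀ ρN ∈ Finset.Icc 2 7, ∃ ν₀ : ℝ, 0 < ν₀ ∧ ∀ ν ∈ Ioc 0 ν₀, ∀ (j₀ J : ℕ), j₀ ≤ J →
      ∀ (hz : Bool) (w₀ : UnitAddTorus (Fin 2) → EuclideanSpace ℝ (Fin 2))
      (w : ℝ → UnitAddTorus (Fin 2) → EuclideanSpace ℝ (Fin 2)) (q : ℝ → UnitAddTorus (Fin 2) → ℝ),
      ShearCombDatum ((⟨γ, 1 / 4, 2, 1, ρN⟩ : CascadeParams).N j₀) hz w₀ →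
      Torus.IsSmoothSpaceTimeOn (Icc (CascadeParams.tInject j₀ hz) (CascadeParams.tStart (J + 2))) w →
      Torus.IsSmoothSpaceTimeOn (Icc (CascadeParams.tInject j₀ hz) (CascadeParams.tStart (J + 2))) q →
      (∀ t ∈ Icc (CascadeParams.tInject j₀ hz) (CascadeParams.tStart (J + 2)), Torus.IsDivFree (w t)) →
      (∀ t ∈ Icc (CascadeParams.tInject j₀ hz) (CascadeParams.tStart (J + 2)), ∀ x,
        Torus.timeDerivWithin (Icc (CascadeParams.tInject j₀ hz) (CascadeParams.tStart (J + 2))) w t x +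
          Torus.convect ((⟨γ, 1 / 4, 2, 1, ρN⟩ : CascadeParams).field t) (w t) x +
          Torus.convect (w t) ((⟨γ, 1 / 4, 2, 1, ρN⟩ : CascadeParams).field t) x =
          ν • Torus.laplacian (w t) x - Torus.gradient (q t) x) →
      w (CascadeParams.tInject j₀ hz) = w₀ →
      ∀ B : ℝ, (∀ t ∈ Icc (CascadeParams.tInject j₀ hz) (CascadeParams.tStart (J + 1)), Torus.vectorL2Sq (w t) ≤ B) →
      ∀ t ∈ Icc (CascadeParams.tStart (J + 1)) (CascadeParams.tStart (J + 2)),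
        Torus.vectorL2Sq (w t) ≤ (3 * Real.exp (sawSigmaStar * γ)) ^ 2 * B := by
  sorry

/-! ## Bookkeeping (sorry-free) -/

/-- The one-sided time derivative within a non-degenerate closed sub-interval agrees with the one within the larger
interval for a jointly smooth field (Mathlib `HasDerivWithinAt.mono` / `.derivWithin`, `uniqueDiffOn_Icc`). -/
theorem timeDerivWithin_Icc_eq_of_subset {a b a' b' : ℝ} (hlt : a' < b')
    (hsub : Icc a' b' ⊆ Icc a b) {w : ℝ → UnitAddTorus (Fin 2) → EuclideanSpace ℝ (Fin 2)}
    (hw : Torus.IsSmoothSpaceTimeOn (Icc a b) w) {t : ℝ} (ht : t ∈ Icc a' b')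
    (x : UnitAddTorus (Fin 2)) :
    Torus.timeDerivWithin (Icc a' b') w t x = Torus.timeDerivWithin (Icc a b) w t x :=
  ((hw.hasDerivWithinAt_slice (hsub ht) x).mono hsub).derivWithin (uniqueDiffOn_Icc hlt t ht)

/-- `0 ≤ ‖v‖²_{L²}`. -/
theorem vectorL2Sq_nonneg (v : UnitAddTorus (Fin 2) → EuclideanSpace ℝ (Fin 2)) : 0 ≤ Torus.vectorL2Sq v := by
  unfold Torus.vectorL2Sq
  exact integral_nonneg fun _ => by positivity

/-- `1 ≤ 3 e^{σ⋆ γ}` for `γ ≥ 0`. -/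
theorem one_le_cap {γ : ℝ} (hγ : 0 ≤ γ) : 1 ≤ 3 * Real.exp (sawSigmaStar * γ) := by
  have h0 : (0 : ℝ) ≤ sawSigmaStar * γ := mul_nonneg (by norm_num [sawSigmaStar]) hγ
  have h1 : 1 ≤ Real.exp (sawSigmaStar * γ) := Real.one_le_exp h0
  linarith

/-- **The uniform envelope by induction over the phases** (the two stubs as hypotheses; no sorry): for
`ν ≤ min ν₀ᴬ ν₀ᴮ` and a classical linearised response from a residual-comb injection at `tInject j₀ hz`, defined up to
`tStart (j₀+n+1)`, `‖w(t)‖²_{L²} ≤ ((3e^{σ⋆γ})²)^{n+1} ‖w₀‖²_{L²}` on the whole window. -/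
theorem envelope_of_stubs
    (hA : ∀ γ ∈ Icc (4 : ℝ) 8, ∀ ρN ∈ Finset.Icc 2 7, ∃ ν₀ : ℝ, 0 < ν₀ ∧ ∀ ν ∈ Ioc 0 ν₀, ∀ (j₀ : ℕ) (hz : Bool)
      (w₀ : UnitAddTorus (Fin 2) → EuclideanSpace ℝ (Fin 2))
      (w : ℝ → UnitAddTorus (Fin 2) → EuclideanSpace ℝ (Fin 2)) (q : ℝ → UnitAddTorus (Fin 2) → ℝ),
      ShearCombDatum ((⟨γ, 1 / 4, 2, 1, ρN⟩ : CascadeParams).N j₀) hz w₀ →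
      Torus.IsSmoothSpaceTimeOn (Icc (CascadeParams.tInject j₀ hz) (CascadeParams.tStart (j₀ + 1))) w →
      Torus.IsSmoothSpaceTimeOn (Icc (CascadeParams.tInject j₀ hz) (CascadeParams.tStart (j₀ + 1))) q →
      (∀ t ∈ Icc (CascadeParams.tInject j₀ hz) (CascadeParams.tStart (j₀ + 1)), Torus.IsDivFree (w t)) →
      (∀ t ∈ Icc (CascadeParams.tInject j₀ hz) (CascadeParams.tStart (j₀ + 1)), ∀ x,
        Torus.timeDerivWithin (Icc (CascadeParams.tInject j₀ hz) (CascadeParams.tStart (j₀ + 1))) w t x +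
          Torus.convect ((⟨γ, 1 / 4, 2, 1, ρN⟩ : CascadeParams).field t) (w t) x +
          Torus.convect (w t) ((⟨γ, 1 / 4, 2, 1, ρN⟩ : CascadeParams).field t) x =
          ν • Torus.laplacian (w t) x - Torus.gradient (q t) x) →
      w (CascadeParams.tInject j₀ hz) = w₀ →
      ∀ t ∈ Icc (CascadeParams.tInject j₀ hz) (CascadeParams.tStart (j₀ + 1)),
        Torus.vectorL2Sq (w t) ≤ (3 * Real.exp (sawSigmaStar * γ)) ^ 2 * Torus.vectorL2Sq w₀)
    (hB : ∀ γ ∈ Icc (4 : ℝ) 8, ∀ ρN ∈ Finset.Icc 2 7, ∃ ν₀ : ℝ, 0 < ν₀ ∧ ∀ ν ∈ Ioc 0 ν₀, ∀ (j₀ J : ℕ), j₀ ≤ J →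
      ∀ (hz : Bool) (w₀ : UnitAddTorus (Fin 2) → EuclideanSpace ℝ (Fin 2))
      (w : ℝ → UnitAddTorus (Fin 2) → EuclideanSpace ℝ (Fin 2)) (q : ℝ → UnitAddTorus (Fin 2) → ℝ),
      ShearCombDatum ((⟨γ, 1 / 4, 2, 1, ρN⟩ : CascadeParams).N j₀) hz w₀ →
      Torus.IsSmoothSpaceTimeOn (Icc (CascadeParams.tInject j₀ hz) (CascadeParams.tStart (J + 2))) w →
      Torus.IsSmoothSpaceTimeOn (Icc (CascadeParams.tInject j₀ hz) (CascadeParams.tStart (J + 2))) q →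
      (∀ t ∈ Icc (CascadeParams.tInject j₀ hz) (CascadeParams.tStart (J + 2)), Torus.IsDivFree (w t)) →
      (∀ t ∈ Icc (CascadeParams.tInject j₀ hz) (CascadeParams.tStart (J + 2)), ∀ x,
        Torus.timeDerivWithin (Icc (CascadeParams.tInject j₀ hz) (CascadeParams.tStart (J + 2))) w t x +
          Torus.convect ((⟨γ, 1 / 4, 2, 1, ρN⟩ : CascadeParams).field t) (w t) x +
          Torus.convect (w t) ((⟨γ, 1 / 4, 2, 1, ρN⟩ : CascadeParams).field t) x =
          ν • Torus.laplacian (w t) x - Torus.gradient (q t) x) →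
      w (CascadeParams.tInject j₀ hz) = w₀ →
      ∀ B : ℝ, (∀ t ∈ Icc (CascadeParams.tInject j₀ hz) (CascadeParams.tStart (J + 1)), Torus.vectorL2Sq (w t) ≤ B) →
      ∀ t ∈ Icc (CascadeParams.tStart (J + 1)) (CascadeParams.tStart (J + 2)),
        Torus.vectorL2Sq (w t) ≤ (3 * Real.exp (sawSigmaStar * γ)) ^ 2 * B) :
    ∀ γ ∈ Icc (4 : ℝ) 8, ∀ ρN ∈ Finset.Icc 2 7, ∃ ν₀ : ℝ, 0 < ν₀ ∧ ∀ ν ∈ Ioc 0 ν₀, ∀ (n j₀ : ℕ) (hz : Bool)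
      (w₀ : UnitAddTorus (Fin 2) → EuclideanSpace ℝ (Fin 2))
      (w : ℝ → UnitAddTorus (Fin 2) → EuclideanSpace ℝ (Fin 2)) (q : ℝ → UnitAddTorus (Fin 2) → ℝ),
      ShearCombDatum ((⟨γ, 1 / 4, 2, 1, ρN⟩ : CascadeParams).N j₀) hz w₀ →
      Torus.IsSmoothSpaceTimeOn (Icc (CascadeParams.tInject j₀ hz) (CascadeParams.tStart (j₀ + n + 1))) w →
      Torus.IsSmoothSpaceTimeOn (Icc (CascadeParams.tInject j₀ hz) (CascadeParams.tStart (j₀ + n + 1))) q →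
      (∀ t ∈ Icc (CascadeParams.tInject j₀ hz) (CascadeParams.tStart (j₀ + n + 1)), Torus.IsDivFree (w t)) →
      (∀ t ∈ Icc (CascadeParams.tInject j₀ hz) (CascadeParams.tStart (j₀ + n + 1)), ∀ x,
        Torus.timeDerivWithin (Icc (CascadeParams.tInject j₀ hz) (CascadeParams.tStart (j₀ + n + 1))) w t x +
          Torus.convect ((⟨γ, 1 / 4, 2, 1, ρN⟩ : CascadeParams).field t) (w t) x +
          Torus.convect (w t) ((⟨γ, 1 / 4, 2, 1, ρN⟩ : CascadeParams).field t) x =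
          ν • Torus.laplacian (w t) x - Torus.gradient (q t) x) →
      w (CascadeParams.tInject j₀ hz) = w₀ →
      ∀ t ∈ Icc (CascadeParams.tInject j₀ hz) (CascadeParams.tStart (j₀ + n + 1)),
        Torus.vectorL2Sq (w t) ≤ ((3 * Real.exp (sawSigmaStar * γ)) ^ 2) ^ (n + 1) * Torus.vectorL2Sq w₀ := by
  intro γ hγ ρN hρ
  obtain ⟨νA, hνA, HA⟩ := hA γ hγ ρN hρ
  obtain ⟨νB, hνB, HB⟩ := hB γ hγ ρN hρ
  refine ⟨min νA νB, lt_min hνA hνB, ?_⟩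
  intro ν hν
  have hνA' : ν ∈ Ioc 0 νA := ⟨hν.1, hν.2.trans (min_le_left _ _)⟩
  have hνB' : ν ∈ Ioc 0 νB := ⟨hν.1, hν.2.trans (min_le_right _ _)⟩
  have hK1 : 1 ≤ (3 * Real.exp (sawSigmaStar * γ)) ^ 2 :=
    one_le_pow₀ (one_le_cap (by linarith [hγ.1]))
  intro n
  induction n with
  | zero =>
    intro j₀ hz w₀ w q hd hw hq hdiv heq h0 t ht
    simp only [Nat.add_zero] at hw hq hdiv heq ht
    calc Torus.vectorL2Sq (w t) ≤ (3 * Real.exp (sawSigmaStar * γ)) ^ 2 * Torus.vectorL2Sq w₀ :=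
          HA ν hνA' j₀ hz w₀ w q hd hw hq hdiv heq h0 t ht
      _ = ((3 * Real.exp (sawSigmaStar * γ)) ^ 2) ^ (0 + 1) * Torus.vectorL2Sq w₀ := by ring
  | succ n ih =>
    intro j₀ hz w₀ w q hd hw hq hdiv heq h0 t ht
    have e : j₀ + (n + 1) + 1 = j₀ + n + 2 := by omega
    rw [e] at hw hq hdiv heq ht
    have hsub : Icc (CascadeParams.tInject j₀ hz) (tStart (j₀ + n + 1)) ⊆
        Icc (CascadeParams.tInject j₀ hz) (tStart (j₀ + n + 2)) :=
      Icc_subset_Icc le_rfl (tStart_strictMono.monotone (by omega))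
    have hlt : CascadeParams.tInject j₀ hz < tStart (j₀ + n + 1) :=
      lt_of_lt_of_le (K2Classical.tInject_lt_tStart_succ j₀ hz) (tStart_strictMono.monotone (by omega))
    have ih' : ∀ s ∈ Icc (CascadeParams.tInject j₀ hz) (tStart (j₀ + n + 1)),
        Torus.vectorL2Sq (w s) ≤ ((3 * Real.exp (sawSigmaStar * γ)) ^ 2) ^ (n + 1) * Torus.vectorL2Sq w₀ :=
      ih j₀ hz w₀ w q hd (hw.mono hsub) (hq.mono hsub) (fun s hs => hdiv s (hsub hs))
        (fun s hs x => by
          rw [timeDerivWithin_Icc_eq_of_subset hlt hsub hw hs x]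
          exact heq s (hsub hs) x) h0
    have hstep := HB ν hνB' j₀ (j₀ + n) (Nat.le_add_right _ _) hz w₀ w q hd hw hq hdiv heq h0
      (((3 * Real.exp (sawSigmaStar * γ)) ^ 2) ^ (n + 1) * Torus.vectorL2Sq w₀) ih'
    have hE0 := vectorL2Sq_nonneg w₀
    rcases le_total t (tStart (j₀ + n + 1)) with h | h
    · calc Torus.vectorL2Sq (w t)
          ≤ ((3 * Real.exp (sawSigmaStar * γ)) ^ 2) ^ (n + 1) * Torus.vectorL2Sq w₀ := ih' t ⟨ht.1, h⟩
        _ ≤ ((3 * Real.exp (sawSigmaStar * γ)) ^ 2) ^ (n + 1 + 1) * Torus.vectorL2Sq w₀ :=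
          mul_le_mul_of_nonneg_right (pow_le_pow_right₀ hK1 (by omega)) hE0
    · calc Torus.vectorL2Sq (w t)
          ≤ (3 * Real.exp (sawSigmaStar * γ)) ^ 2 *
              (((3 * Real.exp (sawSigmaStar * γ)) ^ 2) ^ (n + 1) * Torus.vectorL2Sq w₀) := hstep t ⟨h, ht.2⟩
        _ = ((3 * Real.exp (sawSigmaStar * γ)) ^ 2) ^ (n + 1 + 1) * Torus.vectorL2Sq w₀ := by ring

/-- **Composition with the stubs as hypotheses** (kernel-checked, no sorry): the two stub statements imply the crux. -/
theorem K2LinearisedCascadeGrowth_of_stubs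
    (hA : ∀ γ ∈ Icc (4 : ℝ) 8, ∀ ρN ∈ Finset.Icc 2 7, ∃ ν₀ : ℝ, 0 < ν₀ ∧ ∀ ν ∈ Ioc 0 ν₀, ∀ (j₀ : ℕ) (hz : Bool)
      (w₀ : UnitAddTorus (Fin 2) → EuclideanSpace ℝ (Fin 2))
      (w : ℝ → UnitAddTorus (Fin 2) → EuclideanSpace ℝ (Fin 2)) (q : ℝ → UnitAddTorus (Fin 2) → ℝ),
      ShearCombDatum ((⟨γ, 1 / 4, 2, 1, ρN⟩ : CascadeParams).N j₀) hz w₀ →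
      Torus.IsSmoothSpaceTimeOn (Icc (CascadeParams.tInject j₀ hz) (CascadeParams.tStart (j₀ + 1))) w →
      Torus.IsSmoothSpaceTimeOn (Icc (CascadeParams.tInject j₀ hz) (CascadeParams.tStart (j₀ + 1))) q →
      (∀ t ∈ Icc (CascadeParams.tInject j₀ hz) (CascadeParams.tStart (j₀ + 1)), Torus.IsDivFree (w t)) →
      (∀ t ∈ Icc (CascadeParams.tInject j₀ hz) (CascadeParams.tStart (j₀ + 1)), ∀ x,
        Torus.timeDerivWithin (Icc (CascadeParams.tInject j₀ hz) (CascadeParams.tStart (j₀ + 1))) w t x +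
          Torus.convect ((⟨γ, 1 / 4, 2, 1, ρN⟩ : CascadeParams).field t) (w t) x +
          Torus.convect (w t) ((⟨γ, 1 / 4, 2, 1, ρN⟩ : CascadeParams).field t) x =
          ν • Torus.laplacian (w t) x - Torus.gradient (q t) x) →
      w (CascadeParams.tInject j₀ hz) = w₀ →
      ∀ t ∈ Icc (CascadeParams.tInject j₀ hz) (CascadeParams.tStart (j₀ + 1)),
        Torus.vectorL2Sq (w t) ≤ (3 * Real.exp (sawSigmaStar * γ)) ^ 2 * Torus.vectorL2Sq w₀)
    (hB : ∀ γ ∈ Icc (4 : ℝ) 8, ∀ ρN ∈ Finset.Icc 2 7, ∃ ν₀ : ℝ, 0 < ν₀ ∧ ∀ ν ∈ Ioc 0 ν₀, ∀ (j₀ J : ℕ), j₀ ≤ J →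
      ∀ (hz : Bool) (w₀ : UnitAddTorus (Fin 2) → EuclideanSpace ℝ (Fin 2))
      (w : ℝ → UnitAddTorus (Fin 2) → EuclideanSpace ℝ (Fin 2)) (q : ℝ → UnitAddTorus (Fin 2) → ℝ),
      ShearCombDatum ((⟨γ, 1 / 4, 2, 1, ρN⟩ : CascadeParams).N j₀) hz w₀ →
      Torus.IsSmoothSpaceTimeOn (Icc (CascadeParams.tInject j₀ hz) (CascadeParams.tStart (J + 2))) w →
      Torus.IsSmoothSpaceTimeOn (Icc (CascadeParams.tInject j₀ hz) (CascadeParams.tStart (J + 2))) q →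
      (∀ t ∈ Icc (CascadeParams.tInject j₀ hz) (CascadeParams.tStart (J + 2)), Torus.IsDivFree (w t)) →
      (∀ t ∈ Icc (CascadeParams.tInject j₀ hz) (CascadeParams.tStart (J + 2)), ∀ x,
        Torus.timeDerivWithin (Icc (CascadeParams.tInject j₀ hz) (CascadeParams.tStart (J + 2))) w t x +
          Torus.convect ((⟨γ, 1 / 4, 2, 1, ρN⟩ : CascadeParams).field t) (w t) x +
          Torus.convect (w t) ((⟨γ, 1 / 4, 2, 1, ρN⟩ : CascadeParams).field t) x =
          ν • Torus.laplacian (w t) x - Torus.gradient (q t) x) →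
      w (CascadeParams.tInject j₀ hz) = w₀ →
      ∀ B : ℝ, (∀ t ∈ Icc (CascadeParams.tInject j₀ hz) (CascadeParams.tStart (J + 1)), Torus.vectorL2Sq (w t) ≤ B) →
      ∀ t ∈ Icc (CascadeParams.tStart (J + 1)) (CascadeParams.tStart (J + 2)),
        Torus.vectorL2Sq (w t) ≤ (3 * Real.exp (sawSigmaStar * γ)) ^ 2 * B) :
    K2LinearisedCascadeGrowth := by
  unfold K2LinearisedCascadeGrowth
  intro γ hγ ρN hρ
  obtain ⟨ν₀, hν₀, H⟩ := envelope_of_stubs hA hB γ hγ ρN hρ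
  refine ⟨ν₀, hν₀, fun ν hν j₀ J hj hz w₀ w q hd hw hq hdiv heq h0 t ht => ?_⟩
  obtain ⟨n, rfl⟩ : ∃ n, J = j₀ + n := ⟨J - j₀, by omega⟩
  have h1 := H ν hν n j₀ hz w₀ w q hd hw hq hdiv heq h0 t ⟨(le_max_left _ _).trans ht.1, ht.2⟩
  have e : 2 * (j₀ + n + 1 - j₀) = 2 * (n + 1) := by omega
  rw [e, pow_mul]
  exact h1

/-- **The crux BY NAME from the registered stubs** (closed composition; depends on the two stubs' `sorry`s only). -/
theorem K2LinearisedCascadeGrowth_of : K2LinearisedCascadeGrowth :=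
  K2LinearisedCascadeGrowth_of_stubs stub_injectionPhase stub_phaseCocycle

/-! ## BC5 rungs — PRESENT as theorems (sorry-free citations of landed tree theorems) -/

/-- RUNG 1 (energy-method constant; landed p452366 `K2Classical.k2PhaseGrowthClassical_exp_box`): the restated crux with
the constant `e^{(1−σ⋆)γ} ∈ [15.8, 250]` in place of `3`, for every box point (every `ν`; threshold `ν₀ = 1`). -/
theorem rung_energyConstant :
    ∀ γ ∈ Icc (4 : ℝ) 8, ∀ ρN ∈ Finset.Icc 2 7,
      K2PhaseGrowthClassical ⟨γ, 1 / 4, 2, 1, ρN⟩ (Real.exp ((1 - sawSigmaStar) * γ)) :=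
  K2Classical.k2PhaseGrowthClassical_exp_box

/-- RUNG 2 (injection phase, V half, factor 1, EVERY ν > 0; landed p458821 `K2Classical.k2_injectionPhase_V`): the
`hz = false` half of `stub_injectionPhase` with `1` in place of `(3e^{σ⋆γ})²` and no threshold. -/
theorem rung_injectionPhase_V :
    ∀ γ ∈ Icc (4 : ℝ) 8, ∀ ρN ∈ Finset.Icc 2 7, ∀ ν : ℝ, 0 < ν → ∀ (j₀ : ℕ)
      (w₀ : UnitAddTorus (Fin 2) → EuclideanSpace ℝ (Fin 2))
      (w : ℝ → UnitAddTorus (Fin 2) → EuclideanSpace ℝ (Fin 2)) (q : ℝ → UnitAddTorus (Fin 2) → ℝ),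
      ShearCombDatum ((⟨γ, 1 / 4, 2, 1, ρN⟩ : CascadeParams).N j₀) false w₀ →
      Torus.IsSmoothSpaceTimeOn (Icc (CascadeParams.tInject j₀ false) (CascadeParams.tStart (j₀ + 1))) w →
      Torus.IsSmoothSpaceTimeOn (Icc (CascadeParams.tInject j₀ false) (CascadeParams.tStart (j₀ + 1))) q →
      (∀ t ∈ Icc (CascadeParams.tInject j₀ false) (CascadeParams.tStart (j₀ + 1)), Torus.IsDivFree (w t)) →
      (∀ t ∈ Icc (CascadeParams.tInject j₀ false) (CascadeParams.tStart (j₀ + 1)), ∀ x,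
        Torus.timeDerivWithin (Icc (CascadeParams.tInject j₀ false) (CascadeParams.tStart (j₀ + 1))) w t x +
          Torus.convect ((⟨γ, 1 / 4, 2, 1, ρN⟩ : CascadeParams).field t) (w t) x +
          Torus.convect (w t) ((⟨γ, 1 / 4, 2, 1, ρN⟩ : CascadeParams).field t) x =
          ν • Torus.laplacian (w t) x - Torus.gradient (q t) x) →
      w (CascadeParams.tInject j₀ false) = w₀ →
      ∀ t ∈ Icc (CascadeParams.tInject j₀ false) (CascadeParams.tStart (j₀ + 1)),
        Torus.vectorL2Sq (w t) ≤ Torus.vectorL2Sq w₀ := by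
  intro γ _ ρN _ ν hν j₀ w₀ w q hd hw hq hdiv heq h0 t ht
  have hmax : max (CascadeParams.tInject j₀ false) (tStart j₀) = CascadeParams.tInject j₀ false :=
    max_eq_left (K2Classical.tInject_mem_Icc j₀ false).1
  have := K2Classical.k2_injectionPhase_V ⟨γ, 1 / 4, 2, 1, ρN⟩ (by norm_num) (by norm_num) hν j₀ w₀ w q
    hd hw hq hdiv heq h0 t (by rw [hmax]; exact ht)
  exact this

end Summit.AnomalousDissipation.AnomalousDissipation.Cruxes.K2LinearisedCascadeGrowth.PhaseCocycle

end
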